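import Summits.QuantumFields.QCD.Theses.HeatSlicedQuarks

/-!
# Disproof of `InterleavedHeatSliceFlow` — findings (cdisprove seat, crux stmt-QuantumFields-8891)

Crux (route HeatSlicedQuarks, rank 4, typed as glue):
`InterleavedHeatSliceFlow := SmallFieldUltracontractivity → ActionBoundsLowModes → ContinuumQCDExists`.

VERDICT SO FAR: **no kill is possible in principle short of refuting continuum QCD**. Index of this file:

* §1 `not_crux_iff` — `¬ crux ↔ SFU ∧ ABLM ∧ ¬ ContinuumQCDExists`: a disproof must (i) PROVE both
  typed spectral cruxes 8871/8872 and (ii) REFUTE the route target X₀ = continuum `N_f = 2, 3` QCD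
  without gap clauses; `not_QCD_of_not_crux` — it would also refute the summit conjunct `QCD`.
* §2 load-bearing analysis — the variants with a hypothesis dropped (`…WithoutSFU`, `…WithoutABLM`,
  `…WithoutBoth = X₀`) are each implied by X₀, so NO `_false_without_<H>` theorem can exist unless
  X₀ is false (`not_target_of_false_withoutSFU/ABLM`); conversely under X₀ both hypotheses are idle
  (`hyps_idle_of_target`). The hypotheses carry analytic, not logical, weight: provers get
  `crux ↔ X₀` from them (`crux_iff_target`), nothing more.
* §3 vacuity routes — `crux_of_not_sfu`, `crux_of_not_ablm`: the crux is trivially TRUE if either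
  spectral crux fails; both were audited (free field, constant abelian flux incl. the Wilson-term
  mass shift `m = −F/2`, self-dual flux, dilute dislocations, instanton gas; AM–GM shows the
  `λ²L⁴ + S_W` form of ABLM is exactly borderline for Landau bands) and no counterexample is known;
  numerics job ids are recorded in the seat's NOTES / evidence (kit), not here.
* §4 junk audit of the consequent X₀ — every clause of `ContinuumQCDExists` except the convergence
  of the honest lattice Schwinger functions to NON-TRIVIAL OS data is met by tree witnesses
  (`canonicalAF`: mass scaling, asymptotic scaling, physical branch; the vacuum data ride along the
  `z ≡ 0` scheme but fail `IsNontrivial`): X₀ is neither junk-true nor junk-false; its residual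
  content is constructive QCD itself (open, believed TRUE) — hence unfalsifiable in practice.
* §5 tightness bookkeeping: `landau_band_within_ablm_form` / `landau_band_saturates` (AM–GM: the
  Landau-band family sits inside ABLM's `λ²L⁴ + S_W` form with equality at `λ = f`, `C = 1/(4π²)`).
* §6 mechanism-level notes (determinant sign for `N_f = 3` / split masses; one sequence for all `m`;
  lower bounds for non-triviality). §7 near-misses / what would change the verdict.
-/

namespace Summit.QuantumFields.QCD.Cruxes.InterleavedHeatSliceFlow.Disproof

open Summit.QuantumFields.QCD.Theses.HeatSlicedQuarks
open Literature.MathematicalPhysics.QuantumFieldTheory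
open Filter Topology

/-! ## §1 Logical anatomy of the glue -/

/-- The crux is definitionally the two-hypothesis implication into the route target. [folklore] -/
theorem crux_iff :
    InterleavedHeatSliceFlow ↔
      (SmallFieldUltracontractivity → ActionBoundsLowModes → ContinuumQCDExists) :=
  Iff.rfl

/-- **What a disproof must deliver**: both spectral cruxes proved AND the target refuted. [folklore] -/
theorem not_crux_iff :
    ¬ InterleavedHeatSliceFlow ↔
      (SmallFieldUltracontractivity ∧ ActionBoundsLowModes ∧ ¬ ContinuumQCDExists) := by
  unfold InterleavedHeatSliceFlow
  constructor
  · intro h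
    by_contra hc
    apply h
    intro h1 h2
    by_contra hX
    exact hc ⟨h1, h2, hX⟩
  · rintro ⟨h1, h2, hX⟩ h
    exact hX (h h1 h2)

/-- The target alone proves the crux (hypotheses unused). [folklore] -/
theorem crux_of_target (hX : ContinuumQCDExists) : InterleavedHeatSliceFlow := fun _ _ => hX

/-- Any disproof of the crux is a disproof of the route target X₀. [folklore] -/
theorem not_target_of_not_crux (h : ¬ InterleavedHeatSliceFlow) : ¬ ContinuumQCDExists :=
  fun hX => h (crux_of_target hX)

/-- Given the two spectral cruxes, the crux IS the target: they give no logical discount. [folklore] -/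
theorem crux_iff_target (h1 : SmallFieldUltracontractivity) (h2 : ActionBoundsLowModes) :
    InterleavedHeatSliceFlow ↔ ContinuumQCDExists :=
  ⟨fun h => h h1 h2, fun hX _ _ => hX⟩

/-- The summit conjunct `QCD = QCDOf 2 ∧ QCDOf 3` implies the route target (drop the gap clauses).
[folklore] -/
theorem target_of_QCD (hQ : _root_.QCD) : ContinuumQCDExists := by
  intro Nf hNf
  have key : ∀ N : ℕ, QCDOf N → ∃ reg : QCDRegularisation N, reg.HasMassScaling ∧
      ∀ m : Fin N → ℝ, (∀ f, 0 < m f) → ∃ (z shift : QCDField N → ℕ → ℝ)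
        (T : OSData (QCDField N) 4), IsQCDAlong (reg.scheme m z shift) T ∧
          T.IsNontrivial QCDField.glue ∧ T.IsNonGaussian QCDField.glue ∧
            ∀ f g : Fin N, f ≠ g → T.IsNontrivial (QCDField.pseudoRe f g) := by
    rintro N ⟨reg, hms, hall⟩
    refine ⟨reg, hms, fun m hm => ?_⟩
    obtain ⟨z, shift, T, hA, hN, hG, hP, -⟩ := hall m hm
    exact ⟨z, shift, T, hA, hN, hG, hP⟩
  rcases hNf with rfl | rfl
  · exact key 2 hQ.1
  · exact key 3 hQ.2

/-- **A disproof of this crux would refute the summit conjunct `QCD` as stated.** [folklore] -/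
theorem not_QCD_of_not_crux (h : ¬ InterleavedHeatSliceFlow) : ¬ _root_.QCD :=
  fun hQ => not_target_of_not_crux h (target_of_QCD hQ)

/-! ## §2 Load-bearing analysis (hypotheses dropped one at a time)

For a glue item the "crux without H" is the implication with H deleted. None of the three can be
shown false here: each is a CONSEQUENCE of X₀ (`…_of_target`), so `¬ (crux without H)` would be a
disproof of continuum QCD. This is recorded as the obstruction theorems
`not_target_of_false_withoutSFU/ABLM`. -/

/-- The crux with `SmallFieldUltracontractivity` dropped. [folklore] -/
def InterleavedHeatSliceFlowWithoutSFU : Prop := ActionBoundsLowModes → ContinuumQCDExists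

/-- The crux with `ActionBoundsLowModes` dropped. [folklore] -/
def InterleavedHeatSliceFlowWithoutABLM : Prop := SmallFieldUltracontractivity → ContinuumQCDExists

/-- The crux with both hypotheses dropped is the route target itself. [folklore] -/
def InterleavedHeatSliceFlowWithoutBoth : Prop := ContinuumQCDExists

/-- Dropping both hypotheses leaves exactly X₀. [folklore] -/
theorem withoutBoth_iff_target : InterleavedHeatSliceFlowWithoutBoth ↔ ContinuumQCDExists := Iff.rfl

/-- Each weakened variant implies the crux. [folklore] -/
theorem crux_of_withoutSFU (h : InterleavedHeatSliceFlowWithoutSFU) : InterleavedHeatSliceFlow :=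
  fun _ h2 => h h2

/-- Each weakened variant implies the crux. [folklore] -/
theorem crux_of_withoutABLM (h : InterleavedHeatSliceFlowWithoutABLM) : InterleavedHeatSliceFlow :=
  fun h1 _ => h h1

/-- Each weakened variant is implied by the target. [folklore] -/
theorem withoutSFU_of_target (hX : ContinuumQCDExists) : InterleavedHeatSliceFlowWithoutSFU :=
  fun _ => hX

/-- Each weakened variant is implied by the target. [folklore] -/
theorem withoutABLM_of_target (hX : ContinuumQCDExists) : InterleavedHeatSliceFlowWithoutABLM :=
  fun _ => hX

/-- OBSTRUCTION: a `_false_without_SFU` theorem would disprove continuum QCD (X₀). [folklore] -/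
theorem not_target_of_false_withoutSFU (h : ¬ InterleavedHeatSliceFlowWithoutSFU) :
    ¬ ContinuumQCDExists :=
  fun hX => h (withoutSFU_of_target hX)

/-- OBSTRUCTION: a `_false_without_ABLM` theorem would disprove continuum QCD (X₀). [folklore] -/
theorem not_target_of_false_withoutABLM (h : ¬ InterleavedHeatSliceFlowWithoutABLM) :
    ¬ ContinuumQCDExists :=
  fun hX => h (withoutABLM_of_target hX)

/-- Under X₀ (believed true) both hypotheses are logically idle: every variant collapses to `True`.
[folklore] -/
theorem hyps_idle_of_target (hX : ContinuumQCDExists) :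
    (InterleavedHeatSliceFlowWithoutSFU ↔ InterleavedHeatSliceFlow) ∧
      (InterleavedHeatSliceFlowWithoutABLM ↔ InterleavedHeatSliceFlow) ∧
        (InterleavedHeatSliceFlowWithoutBoth ↔ InterleavedHeatSliceFlow) :=
  ⟨⟨fun _ => crux_of_target hX, fun _ => withoutSFU_of_target hX⟩,
    ⟨fun _ => crux_of_target hX, fun _ => withoutABLM_of_target hX⟩,
    ⟨fun _ => crux_of_target hX, fun _ => hX⟩⟩

/-- What the hypotheses DO buy logically: modulo the sibling cruxes the weakened variants, the crux
and the target are all one statement. [folklore] -/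
theorem all_iff_target (h1 : SmallFieldUltracontractivity) (h2 : ActionBoundsLowModes) :
    (InterleavedHeatSliceFlowWithoutSFU ↔ ContinuumQCDExists) ∧
      (InterleavedHeatSliceFlowWithoutABLM ↔ ContinuumQCDExists) ∧
        (InterleavedHeatSliceFlow ↔ ContinuumQCDExists) :=
  ⟨⟨fun h => h h2, fun hX _ => hX⟩, ⟨fun h => h h1, fun hX _ => hX⟩, crux_iff_target h1 h2⟩

/-! ## §3 Vacuity routes (the only cheap way the crux could close is a FALSE sibling crux) -/

/-- If scale-covariant small-field ultracontractivity (8871) fails, the crux holds vacuously.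
[folklore] -/
theorem crux_of_not_sfu (h : ¬ SmallFieldUltracontractivity) : InterleavedHeatSliceFlow :=
  fun h1 => absurd h1 h

/-- If the action bound on low modes (8872) fails, the crux holds vacuously. [folklore] -/
theorem crux_of_not_ablm (h : ¬ ActionBoundsLowModes) : InterleavedHeatSliceFlow :=
  fun _ h2 => absurd h2 h

/-- Trichotomy for the seat: the crux is (vacuously) provable, or it is literally X₀. [folklore] -/
theorem crux_provable_or_is_target :
    (¬ SmallFieldUltracontractivity ∨ ¬ ActionBoundsLowModes) ∨
      (InterleavedHeatSliceFlow ↔ ContinuumQCDExists) := by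
  by_cases h1 : SmallFieldUltracontractivity
  · by_cases h2 : ActionBoundsLowModes
    · exact Or.inr (crux_iff_target h1 h2)
    · exact Or.inl (Or.inr h2)
  · exact Or.inl (Or.inl h1)

/-! ## §4 Junk audit of the consequent `ContinuumQCDExists`

X₀ quantifies `∃ reg, reg.HasMassScaling ∧ ∀ m > 0, ∃ z shift T, IsQCDAlong (reg.scheme m z shift) T
∧ T.IsNontrivial glue ∧ T.IsNonGaussian glue ∧ ∀ f ≠ g, T.IsNontrivial (pseudoRe f g)`.
The theorems below show that the regularisation clause, the asymptotic-scaling clause and the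
physical-branch clause of `IsQCDAlong` are all inhabited by the tree's `canonicalAF`, and that the
Schwinger-function convergence clause is inhabited too — but only by the vacuum data along the
`z ≡ 0` scheme, which the non-triviality clause rejects. So X₀ is not true for a junk reason
(vacuum excluded) and not false for a junk reason (no clause is unsatisfiable on its own): what is
left is the honest convergence of lattice QCD `n`-point functions to non-trivial OS data. -/

/-- The regularisation clause is inhabited with leading-log mass scaling (tree `canonicalAF`).
[folklore] -/
theorem reg_clause_inhabited (Nf : ℕ) : ∃ reg : QCDRegularisation Nf, reg.HasMassScaling :=
  ⟨QCDRegularisation.canonicalAF Nf, QCDRegularisation.canonicalAF_hasMassScaling⟩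

/-- Along `canonicalAF` the bare coupling scales asymptotically (Λ = 1) for every mass tuple and
every species renormalisation. [folklore] -/
theorem canonicalAF_scheme_hasAsymptoticScaling (Nf : ℕ) (m : Fin Nf → ℝ)
    (z shift : QCDField Nf → ℕ → ℝ) :
    ((QCDRegularisation.canonicalAF Nf).scheme m z shift).HasAsymptoticScaling := by
  refine ⟨1, one_pos, ?_⟩
  have h : (fun k => ((QCDRegularisation.canonicalAF Nf).scheme m z shift).β k -
      afBeta Nf 1 (((QCDRegularisation.canonicalAF Nf).scheme m z shift).a k)) = fun _ => 0 := by
    funext k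
    exact sub_eq_zero.mpr rfl
  rw [h]
  exact tendsto_const_nhds

/-- Along `canonicalAF` (`m_crit ≡ 0`) positive renormalised masses keep every bare mass on the
physical branch `m_f(k) > −1` (indeed `> 0`). [folklore] -/
theorem canonicalAF_scheme_physicalBranch (Nf : ℕ) (m : Fin Nf → ℝ) (hm : ∀ f, 0 < m f)
    (z shift : QCDField Nf → ℕ → ℝ) (fl : Fin Nf) :
    ∀ᶠ k in atTop, -1 < ((QCDRegularisation.canonicalAF Nf).scheme m z shift).mq fl k := by
  refine Eventually.of_forall fun k => ?_
  have ha := (QCDRegularisation.canonicalAF Nf).a_pos k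
  have hZ := (QCDRegularisation.canonicalAF Nf).Zm_pos k
  have h1 : (0 : ℝ) < (QCDRegularisation.canonicalAF Nf).a k * m fl /
      (QCDRegularisation.canonicalAF Nf).Zm k := div_pos (mul_pos ha (hm fl)) hZ
  have h2 : ((QCDRegularisation.canonicalAF Nf).scheme m z shift).mq fl k =
      0 + (QCDRegularisation.canonicalAF Nf).a k * m fl / (QCDRegularisation.canonicalAF Nf).Zm k :=
    rfl
  rw [h2]
  linarith

/-- The vacuum data are never a witness for X₀: they fail the glue non-triviality clause (tree
`OSData.not_isNontrivial_vacuum`), whatever scheme they ride along. [folklore] -/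
theorem vacuum_not_a_witness (Nf : ℕ) (sch : QCDScheme Nf) :
    ¬ (IsQCDAlong sch (OSData.vacuum (QCDField Nf) 4) ∧
        (OSData.vacuum (QCDField Nf) 4).IsNontrivial QCDField.glue) :=
  fun h => OSData.not_isNontrivial_vacuum _ h.2

/-- The convergence clause alone IS inhabited (by the vacuum along the degenerate scheme, tree
`isQCDAlong_zeroAF_vacuum`): it is the conjunction with non-triviality that carries the problem.
[folklore] -/
theorem convergence_clause_inhabited (Nf : ℕ) :
    ∃ (sch : QCDScheme Nf) (T : OSData (QCDField Nf) 4), IsQCDAlong sch T :=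
  ⟨_, _, isQCDAlong_zeroAF_vacuum Nf⟩

/-- **Residual content of X₀ after the junk audit** (restated so provers see the exact shape): for
`N_f ∈ {2, 3}`, SOME regularisation with mass scaling carries, for every positive mass tuple,
species renormalisations and OS data that are QCD along the scheme AND non-trivial. Definitionally
X₀. [folklore] -/
theorem target_iff :
    ContinuumQCDExists ↔
      ∀ Nf : ℕ, Nf = 2 ∨ Nf = 3 → ∃ reg : QCDRegularisation Nf, reg.HasMassScaling ∧
        ∀ m : Fin Nf → ℝ, (∀ f, 0 < m f) → ∃ (z shift : QCDField Nf → ℕ → ℝ)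
          (T : OSData (QCDField Nf) 4), IsQCDAlong (reg.scheme m z shift) T ∧
            T.IsNontrivial QCDField.glue ∧ T.IsNonGaussian QCDField.glue ∧
              ∀ f g : Fin Nf, f ≠ g → T.IsNontrivial (QCDField.pseudoRe f g) :=
  Iff.rfl

/-! ## §5 Why the hypotheses resist (tightness bookkeeping the provers can reuse)

The only cheap closure of this crux is a FALSE sibling crux (§3). Both were attacked; the
structural reason they survive in the scaling regime is dimensional: with a smooth background of
curvature scale `f` (lattice units), `N(λ)/L⁴`, `λ²` and the action density `f²` are all
homogeneous of degree 2 in inverse length², so every scale-invariant mode-producing mechanism gives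
`N/L⁴ = g(f, λ)` with `g` degree-2 homogeneous, and ABLM's form `λ²L⁴ + S_W` bounds it as soon as `g`
is bounded on the unit circle (it is: `λ → 0` at fixed `f` is the index density `∝ f²`, `f → 0` at
fixed `λ` is the free Weyl law `∝ λ²`). The Landau-band family (constant abelian flux `f` in one
plane, Wilson-term shift absorbed by the admissible mass `m = −f/2 ∈ [−1/2, 0)`, free motion in the
other two directions) realises `g(f, λ) ≈ fλ/(2π²)`; the lemma below is the one-line AM–GM showing it
sits INSIDE the crux's form with `C = 1/(4π²)` and equality at `λ = f` — so ABLM's constant cannot be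
better than about `1/(4π²)` there, the `S_W` term cannot be weakened to `S_W^c, c < 1` (self-dual
flux: `≈ 4n²` exact zero modes against `S_W ≈ 8π²n²`), and the `λ²` term is pinned by the free field.
Violations can only come from lattice-scale structures, where rough fields are gapped
(strong-coupling bound on `D_W`) and each dislocation binds `O(1)` modes for `O(1)` action. -/

/-- **Landau bands sit inside the ABLM form (AM–GM), with equality at `λ = f`.** For a band count
`f·λ·V/(2π²)` (`V = L⁴`; `f` = flux density, `λ` = spectral level) one has
`fλV/(2π²) ≤ (1/(4π²))·(λ²V + f²V)`; the difference is `V(λ − f)²/(4π²)`. [folklore] -/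
theorem landau_band_within_ablm_form (f lam V : ℝ) (hV : 0 ≤ V) :
    f * lam * V / (2 * Real.pi ^ 2) ≤ (1 / (4 * Real.pi ^ 2)) * (lam ^ 2 * V + f ^ 2 * V) := by
  have hπ : 0 < Real.pi ^ 2 := by positivity
  have key : (1 / (4 * Real.pi ^ 2)) * (lam ^ 2 * V + f ^ 2 * V) - f * lam * V / (2 * Real.pi ^ 2)
      = V * (lam - f) ^ 2 / (4 * Real.pi ^ 2) := by
    field_simp
    ring
  have hnn : 0 ≤ V * (lam - f) ^ 2 / (4 * Real.pi ^ 2) :=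
    div_nonneg (mul_nonneg hV (sq_nonneg _)) (by positivity)
  linarith [key, hnn]

/-- **The equality case** `λ = f`: the Landau family saturates the constant `1/(4π²)`. [folklore] -/
theorem landau_band_saturates (f V : ℝ) :
    f * f * V / (2 * Real.pi ^ 2) = (1 / (4 * Real.pi ^ 2)) * (f ^ 2 * V + f ^ 2 * V) := by
  have hπ : Real.pi ^ 2 ≠ 0 := by positivity
  field_simp
  ring

/-! ## §6 Mechanism-level notes for the informal content (no bearing on the typed verdict)

* `Literature.Barriers.QuantumFields.WilsonDeterminantSign` (proved in tree): for `N_f = 3` (odd) and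
  for non-degenerate `N_f = 2` tuples — both inside X₀'s `∀ m > 0` — the honest fermion-integrated
  weight `e^{−βS} ∏_f det D_W(U, m_f(k), 1)` is SIGNED on odd-index configurations once the bare
  masses `m_crit(k) + a_k m_f/Z_m(k)` sit in the level-crossing region (`m_crit(k) < 0` is the
  expected Wilson critical line). The route's Barriers section does not list it. It does not bite
  the typed crux (an implication) and is evaded by the mechanism only insofar as the fermions are
  EXPANDED (Gram/determinant bounds in absolute value, polymer expansion) and never sampled as a
  probability weight; any step of the interleaved flow phrased as "bad blocks are rare under the
  measure" must be re-phrased as an absolute bound. Worth a line in the route text.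
* `Literature.Barriers.QuantumFields.UVStabilityNonUniqueness`: X₀ fixes ONE regularisation before
  the mass tuple (`∃ reg, … ∀ m`) and asks `Tendsto … atTop` along the WHOLE sequence for a continuum
  of tuples `m`; stability/compactness alone yields per-`m` subsequences. A diagonal choice of a
  sparse `reg.a` serves countably many tuples; the rest needs equicontinuity of the lattice
  Schwinger functions in `m` uniformly in `k` (cf. tree `IsMassEquicontinuous`,
  QCDCalibratedSpecies.lean) or genuine convergence. This is the "one sequence a_k serving ALL mass
  tuples" item of the target's why-might-fail, inherited verbatim by this crux via `crux_iff_target`.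
* Non-triviality clauses need LOWER bounds: `T.IsNontrivial glue` / `pseudoRe f g` require a
  truncated two-point function bounded away from `0` uniformly in `k` at some time-separated test
  functions — an asymptotic-freedom short-distance statement, not a stability bound.

## §7 Near-misses and what would change the verdict (no sorries kept)

* A kernel-checked `¬ SmallFieldUltracontractivity` or `¬ ActionBoundsLowModes` would make this crux
  a one-line theorem (`crux_of_not_sfu/ablm`) — and break the route elsewhere. Attacked on paper
  (free field all `m ∈ [−1/2, 1]`: gap `m²`, Weyl count `∝ λ²L⁴`; constant abelian flux with the
  Wilson shift absorbed by `m = −f/2`: §5; self-dual flux; dilute dislocations / instanton gas: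
  linear; very rough fields: gapped) and numerically. NUMERICS 1 (kit job j008078, tree conventions
  transcribed: `D(p) = (m+4)·1 − ½Σ_μ[e^{ip_μ}(1−γ_μ)⊗U_μ + e^{−ip_μ}(1+γ_μ)⊗U_μ†]`, Clifford and
  γ-hermiticity checked): CONSTANT non-abelian links `U_μ = exp(iηA_μ)` (random traceless `A_μ`,
  su(2)-isotropic, one chromomagnetic plane, "self-dual-like" two planes, abelian Polyakov twists),
  `η ∈ {1, .8, .6, .4, .25, .2, .15, .1, .08, .05, .04}`, `m ∈ {−.5, −.4, −.3, −.2, −.1, −.05, −.02,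
  0, .1, .5, 1}`, `L ∈ {4, 8}` — EXACT spectra (the torus operator is block-diagonal in momentum),
  506 cases. ABLM: `sup_λ N_L(λ)/(λ²L⁴ + S_W + 1) = 12.0`, attained ONLY by the 12 constant zero
  modes of the free field at `λ = 0` (the `+1` term: `C ≥ 12` is forced); every other ratio above `1`
  (max `11.6`) has `N ≤ 12`, `S_W < 1` — the `p = 0` block pushed towards zero, again the constant
  term; away from it all ratios `≤ 0.35`. Dimensional reason: this family has action density
  `≈ 5.9 η⁴` per site against a maximal low-mode density `12·vol{|p| ≲ η}/(2π)⁴ ≈ 0.04 η⁴`, so it can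
  never threaten ABLM (ratio `≲ 10⁻²` in the scaling regime) — the abelian Landau family of §5
  (ratio `1/(4π²)`) remains the worst smooth case known. SFU: over every admissible window
  (`ε ∈ {0.3, 1}`, plaquette deviation `≤ (ε/r²)²`, `1 ≤ t ≤ r² ≤ L²`) `sup t²·max|e^{−tH}(x,x)| ≤ 0.98`
  (the free zero mode at `t = L²`), and even unconditionally over all `t ≤ L²` it is `≤ 1.06` on this
  family; rough members (`η ≥ 0.6`) are gapped (`t²K ≤ 0.33`). NUMERICS 2 (kit job j008411, exact
  dense diagonalisation of `H = D_W†D_W` (3072 × 3072) on the `4⁴` torus, 94 cases; the tree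
  conventions were validated inside the job: `AccretiveWilsonDirac` identity to `1.8·10⁻¹¹` on a
  random configuration, γ₅-hermiticity exact): dislocations = `k` Haar-random links,
  `k ∈ {1, 2, 4, …, 1024}`; everywhere-rough `U = exp(iηA)`, `η ∈ {.1, .3, .6, 1}`; abelian flux
  `n ∈ {1, 2, 3}` in one plane and self-dual, each also at the Wilson-shift-cancelling mass
  `m = −f/2` (resp. `−f`); thin centre vortex; `m ∈ {−.5, −.25, 0, .5}`. ABLM: the ONLY ratio above
  `0.70` is again the free `12.0`; dislocations give `0.68 (k=1) → 0.05 (k=1024)`, monotonically —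
  few random links merely perturb the 12 constant modes (`+1` term), many random links GAP the
  operator (`λ_min(H) = 0.14` at `k = 256`, `1.26` at `k = 1024`; `η ≥ 0.6` everywhere-rough:
  `λ_min ≥ 0.66`) exactly as the strong-coupling bound predicts; flux at `m = −f/2`: `≤ 0.14` with at
  most 12 modes below `10⁻²`; self-dual `n = 1` has its 4 index zero modes against `S_W = 78`
  (`0.05`); centre vortex `0.09`. SFU local ball test (`K ∈ {1,2}`, `ε ∈ {0.3, 1}`): every admissible
  `(x, r)` has `sup_{t ≤ r²} t²·max|e^{−tH}(x,x)| ≤ 1.00` (free zero mode), `≤ 0.034` in every gauge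
  field — but at `L = 4` almost only `r = 1` balls are admissible, so this part is weak; the `6⁴`
  leg died on the node's memory cap (the momentum-block job covers smooth backgrounds to `t = 60`).
  Across ≈ 600 exact cases: `C_ABLM = 12` (forced and sufficient), `C_SFU ≈ 1`. No witness.
* A junk inhabitant of X₀ (vacuum, white noise from a mis-scaled or heavy-quark scheme) is excluded:
  `IsNontrivial` tests the truncated two-point function at time-SEPARATED arguments, where white
  noise vanishes, and `IsQCDAlong` pins `β_k` to the two-loop profile and `a_k L_k → ∞` (§4).
* Hence `¬ InterleavedHeatSliceFlow` is equivalent to "8871 ∧ 8872 ∧ continuum QCD (N_f = 2 or 3,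
  Wilson, AF scheme, mass scaling) does not exist" — the last conjunct contradicts the universally
  expected answer and would by `not_QCD_of_not_crux` settle the summit conjunct negatively:
  a barrier to refutation, not a barrier entry.
-/

end Summit.QuantumFields.QCD.Cruxes.InterleavedHeatSliceFlow.Disproof
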